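import Literature.Combinatorics.Sahi2008.GeneratingFunction
import Summits.CriticalPhenomena.PercolationContinuityZ3.Theorems.PercNearOneGluingNoHeavyLowerTailSahiCombSubstitutionAllOrders
import Summits.CriticalPhenomena.PercolationContinuityZ3.Theorems.PercNearOneGluingNoHeavyLowerTailSahiCombCubeFiveAllOrders
import Summits.CriticalPhenomena.PercolationContinuityZ3.Theorems.PercNearOneGluingNoHeavyLowerTailSahiSymCubeFiveTen

/-!
# Five independent block events, EVERY ORDER, EVERY DIMENSION — Sahi's `C_n` (value and comb level) and Conjecture 4 (power series)
# for monotone functions of the occurrence vector of at most five increasing events with pairwise disjoint supports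

Support file (cell `prim-sahi`, seat `prim-sahi-typer` gen 36; `--supports stmt-CriticalPhenomena-4575`; proposed `--computational`: the
closure contains the declared `native_decide` axioms of the five-letter all-orders certificates — `…SahiCombCubeFiveAllOrders`
(`SahiCombFive.combPos_sahiE_of_card_le_five_all`, comb level) and `…SahiSymCubeFiveTen` (`SahiSymCube.sahiPositive_bernoulliWeight_of_card_le_five_all`,
value level); nothing else non-standard, no `sorry`, no definitions).

Instantiating the all-orders block-substitution transfer of `…SahiCombSubstitutionAllOrders` (this generation, pure):
`r ≤ 5` events `X_0,…,X_{r−1} ⊆ 2^ι` determined by pairwise disjoint coordinate sets (they need not be increasing), bit vector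
`bits X ω = {j | ω ∈ X_j}`, product weight `μ_p` on `2^ι`, ANY finite `ι`.
* **`sahiE_comp_bits_nonneg_le_five`** (value level): for every `n` and all nonnegative monotone `f_0,…,f_{n−1} : 2^{Fin r} → ℝ`,
  `E_n(μ_p; f_0 ∘ bits X, …, f_{n−1} ∘ bits X) ≥ 0` — Sahi's `n`-function inequality [Sahi2008, Conj. 5; LiebSahi2022, Conj. 1.1] for every `n`
  on the class of monotone functions of five independent block events, every product measure, every dimension;
* **`combPos_sahiE_subst_le_five`** (comb level, (M⁺-n)): for increasing patterns `Φ_0,…,Φ_{n−1} ⊆ 2^{Fin r}` the polynomial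
  `p ↦ E_n(μ_p; 1_{subst X Φ_0}, …)` is a nonnegative combination of the degree-`n` tensor-Bernstein basis on `[0,1]^ι`; law level
  `sahiE_subst_nonneg_le_five`, density-free zero set `sahiE_subst_eq_zero_of_interior_zero_le_five`;
* **`sahiSeries_comp_bits_coeff_nonneg_le_five`** (Sahi's Conjecture 4 on the class): every coefficient of
  `1 − ∏_ω (1 − Σ_{i≥1} f_i(bits X ω) t^i)^{μ_p(ω)}` is nonnegative for nonnegative monotone `f_1, f_2, …` on `2^{Fin r}`.
HONEST LABEL: computational (closure as stated); these are the five-block CASES — Sahi's conjectures remain OPEN in general. [this work]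
-/

noncomputable section

open scoped Classical

namespace Summit.CriticalPhenomena.PercolationContinuityZ3.Theorems

namespace SahiCombSubstitution

open Finset Function PowerSeries
open Literature.Combinatorics.Sahi2008
open Literature.Probability.Percolation (DeterminedBy)
open Literature.Probability.Percolation.DecisionTree (ind ind_nonneg)
open SahiComb

variable {ι : Type} [Fintype ι] {r : ℕ}

/-! ### Value level, every order -/

/-- **Sahi's `C_n` for monotone functions of at most five independent block events** — every order `n`, every product measure, every
dimension. [this work] [computational] -/
theorem sahiE_comp_bits_nonneg_le_five (p : ι → unitInterval) (hr : r ≤ 5) (X : Fin r → Set (Set ι)) (S : Fin r → Finset ι)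
    (hS : (Set.univ : Set (Fin r)).PairwiseDisjoint S) (hXd : ∀ j, DeterminedBy (X j) (↑(S j) : Set ι)) (n : ℕ)
    (f : Fin n → Set (Fin r) → ℝ) (hf0 : ∀ i η, 0 ≤ f i η) (hfm : ∀ i, Monotone (f i)) :
    0 ≤ sahiE (bernoulliWeight p) n (fun i => f i ∘ bits X) :=
  sahiE_comp_bits_nonneg_of_sahiPositive p X S hS hXd
    (SahiSymCube.sahiPositive_bernoulliWeight_of_card_le_five_all (by simpa using hr) (blockParam p X) n) f hf0 hfm

/-- The whole class at once: the push-forward of `μ_p` along the bit vector is Sahi-positive of every order. [this work] [computational] -/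
theorem sahiPositive_pushWeight_bits_le_five (p : ι → unitInterval) (hr : r ≤ 5) (X : Fin r → Set (Set ι)) (S : Fin r → Finset ι)
    (hS : (Set.univ : Set (Fin r)).PairwiseDisjoint S) (hXd : ∀ j, DeterminedBy (X j) (↑(S j) : Set ι)) (n : ℕ) :
    SahiPositive (pushWeight (bernoulliWeight p) (bits X)) n := by
  rw [pushWeight_bits p X S hS hXd]
  exact SahiSymCube.sahiPositive_bernoulliWeight_of_card_le_five_all (by simpa using hr) (blockParam p X) n

/-- **Sahi's Conjecture 4 (power-series form) on the class**: all coefficients of `1 − ∏_ω (1 − Σ_i f_i(bits X ω) t^i)^{μ_p(ω)}` are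
nonnegative for nonnegative monotone `f_1, f_2, …` on `2^{Fin r}`, `r ≤ 5`. [this work] [computational] -/
theorem sahiSeries_comp_bits_coeff_nonneg_le_five (p : ι → unitInterval) (hr : r ≤ 5) (X : Fin r → Set (Set ι)) (S : Fin r → Finset ι)
    (hS : (Set.univ : Set (Fin r)).PairwiseDisjoint S) (hXd : ∀ j, DeterminedBy (X j) (↑(S j) : Set ι))
    (f : ℕ → Set (Fin r) → ℝ) (hf0 : ∀ i η, 0 ≤ f i η) (hfm : ∀ i, Monotone (f i)) (M : ℕ) :
    0 ≤ coeff M (sahiSeries (bernoulliWeight p) (fun i => f i ∘ bits X)) := by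
  refine coeff_sahiSeries_nonneg_of_forall_sahiE_nonneg (bernoulliWeight p) (sum_bernoulliWeight p)
    (fun g => ∃ h : Set (Fin r) → ℝ, (∀ η, 0 ≤ h η) ∧ Monotone h ∧ g = h ∘ bits X) (fun n g hg => ?_)
    (fun i => f i ∘ bits X) (fun i => ⟨f i, hf0 i, hfm i, rfl⟩) M
  choose h hh0 hhm hgh using hg
  have hfun : g = fun i => h i ∘ bits X := funext hgh
  rw [hfun]
  exact sahiE_comp_bits_nonneg_le_five p hr X S hS hXd n h hh0 hhm

/-! ### Comb level, every order -/

/-- **(M⁺-n) for substituted families with at most five blocks**, every order `n`, every dimension: `p ↦ E_n(μ_p; 1_{subst X Φ_0}, …)` is a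
nonnegative combination of the degree-`n` tensor-Bernstein basis (patterns certified on the `5`-cube by
`SahiCombFive.combPos_sahiE_of_card_le_five_all`). [this work] [computational] -/
theorem combPos_sahiE_subst_le_five (hr : r ≤ 5) (X : Fin r → Set (Set ι)) (S : Fin r → Finset ι)
    (hS : (Set.univ : Set (Fin r)).PairwiseDisjoint S) (hXd : ∀ j, DeterminedBy (X j) (↑(S j) : Set ι)) (n : ℕ)
    (Φ : Fin n → Set (Set (Fin r))) (hΦ : ∀ i, IsUpperSet (Φ i)) :
    CombPos (fun _ : ι => n) (fun p => sahiE (bernoulliWeight p) n (fun i => ind (subst X (Φ i)))) :=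
  combPos_sahiE_subst n X S hS hXd Φ (SahiCombFive.combPos_sahiE_of_card_le_five_all (by simpa using hr) n Φ hΦ)

/-- Law level: `E_n(μ_p; 1_{subst X Φ_0}, …) ≥ 0` for increasing patterns of at most five independent block events, every order, every product
measure, every dimension. [this work] [computational] -/
theorem sahiE_subst_nonneg_le_five (p : ι → unitInterval) (hr : r ≤ 5) (X : Fin r → Set (Set ι)) (S : Fin r → Finset ι)
    (hS : (Set.univ : Set (Fin r)).PairwiseDisjoint S) (hXd : ∀ j, DeterminedBy (X j) (↑(S j) : Set ι)) (n : ℕ)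
    (Φ : Fin n → Set (Set (Fin r))) (hΦ : ∀ i, IsUpperSet (Φ i)) :
    0 ≤ sahiE (bernoulliWeight p) n (fun i => ind (subst X (Φ i))) :=
  (combPos_sahiE_subst_le_five hr X S hS hXd n Φ hΦ).nonneg p

/-- Density-free zero set on the class: if `E_n(μ_q; 1_{subst X Φ})` vanishes at ONE interior point `q ∈ (0,1)^ι` then it vanishes for every
`p ∈ [0,1]^ι`. [this work] [computational] -/
theorem sahiE_subst_eq_zero_of_interior_zero_le_five (hr : r ≤ 5) (X : Fin r → Set (Set ι)) (S : Fin r → Finset ι)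
    (hS : (Set.univ : Set (Fin r)).PairwiseDisjoint S) (hXd : ∀ j, DeterminedBy (X j) (↑(S j) : Set ι)) (n : ℕ)
    (Φ : Fin n → Set (Set (Fin r))) (hΦ : ∀ i, IsUpperSet (Φ i)) {q : ι → unitInterval}
    (hq : ∀ e, (q e : ℝ) ∈ Set.Ioo (0 : ℝ) 1) (h0 : sahiE (bernoulliWeight q) n (fun i => ind (subst X (Φ i))) = 0)
    (p : ι → unitInterval) : sahiE (bernoulliWeight p) n (fun i => ind (subst X (Φ i))) = 0 :=
  (combPos_sahiE_subst_le_five hr X S hS hXd n Φ hΦ).eq_zero_of_interior hq h0 p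

end SahiCombSubstitution

end Summit.CriticalPhenomena.PercolationContinuityZ3.Theorems
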